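import Mathlib
import Summits.ValiantsHypothesis.ValiantsHypothesis.Theses.FeketeSOS
import Summits.ValiantsHypothesis.ValiantsHypothesis.Theorems.SOSMagnification.Negative.FeketeTwoSquaresStructure
import Summits.ValiantsHypothesis.ValiantsHypothesis.Theorems.FeketeSOSThinSquaresCovering

/-!
# `SublinearShadow` — kill criterion: what a refutation must contain (the double wall)

Crux `stmt-ValiantsHypothesis-14990` = `Summit.ValiantsHypothesis.ValiantsHypothesis.Theses.FeketeSOS.SublinearShadow`
(route FeketeSOS, rank 5).  Standing disprover (cdisprove gen 1, cycle 1), work file `Cruxes/SublinearShadow/Disproof.lean` §W.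
Unpacking the negation: `¬SublinearShadow` holds iff for every `A, p₁` some prime `p ≥ p₁` carries a SUBLINEAR complex
representation `Σ_{i<s} c_i g_i² = F_p` (`S⁴ ≤ p³`, `S = Σ|supp g_i|`) with NO characteristic-`p` cyclic representation of
`F̄_p` by `≤ (s+1)^A` weighted squares of total support `≤ (s+1)^A·S`.  Two necessary ingredients of any refutation follow:

* `exists_sublinearRep_of_not_sublinearShadow` (wall W1) — sublinear complex SOS representations of `F_p` (degree `≤ p²`,
  `S⁴ ≤ p³`, hence `s ≥ 2`) must EXIST for infinitely many primes.  None is known for any prime (exhaustive minima are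
  linear in `p` for `p ≤ 11`; every structured search of the sibling cruxes returned `Θ(p)`); if they do not exist for large
  `p` the crux is true vacuously (it is implied by the thesis `FeketeSOSHard` at exponent `3/4` without its `s ≤ p^δ` cap).
* `charP_hard_of_not_sublinearShadow` (wall W2) — for EVERY `D` and infinitely many primes `p`, `F̄_p` must have NO cyclic
  characteristic-`p` representation `X^p − 1 ∣ Σ_{j<d} c'_j g'_j² − F̄_p` with `d ≤ D` squares of degree `< p` and total
  support `T` with `2T² ≤ D²(p−1)`, i.e. `T ≤ D·√((p−1)/2)`: a bounded-fan-in char-`p` lower bound beating the counting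
  bound by the factor `D`.  For `D ≤ 2` this is the landed linear bound `(p+3)/2` (`feketeNoSparseCyclicSplit`); for `D ≥ 3`
  nothing beyond counting is known — it is a weak form of the sibling crux `CharPSparseSOS` (★).
  (Proof: otherwise the cheap char-`p` representations themselves satisfy the crux's conclusion with `A = D`, because every
  complex representation has `s ≥ 2` — `two_le_of_feketeRep` — and `2(p−1) ≤ S(S+1)` — `two_mul_pred_le_of_feketeRep`,
  the counting lemma of `ThinSquaresCovering` — whence `d ≤ D ≤ 2^D ≤ (s+1)^D` and `T ≤ D·S ≤ (s+1)^D·S`.)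
So a kill is (a new Gauss-sum-type identity for `F_p`) ∧ (a new char-`p` sparsity theorem), at the same primes. [folklore]
-/

namespace Summit.ValiantsHypothesis.ValiantsHypothesis.Theorems.SublinearShadow.Negative

open Polynomial Finset
open scoped BigOperators
open Summit.ValiantsHypothesis.ValiantsHypothesis.Theses.FeketeSOS
open Summit.ValiantsHypothesis.ValiantsHypothesis.Theorems.SOSMagnification.Negative (two_le_of_feketeRep)

-- `Summit.ValiantsHypothesis.ValiantsHypothesis.…` is the tree's mandated single-conjunct layout (Sub = Summit).
set_option linter.dupNamespace false

noncomputable section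

/-- `𝔉⟮p⟯ = F_p = ∑_{m<p} (m|p) X^m`, the crux's literal right-hand side. -/
local notation3 "𝔉⟮" p "⟯" =>
  (∑ m ∈ Finset.range p, Polynomial.C ((legendreSym p m : ℤ) : ℂ) * (Polynomial.X : Polynomial ℂ) ^ m)

/-- **Wall W1.**  If the crux fails then for every threshold some prime beyond it carries a SUBLINEAR complex weighted SOS
representation of `F_p` (degree `≤ p²`, `S⁴ ≤ p³`), necessarily with `s ≥ 2` squares. [folklore] -/
theorem exists_sublinearRep_of_not_sublinearShadow (h : ¬ SublinearShadow) (p₁ : ℕ) :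
    ∃ (p : ℕ) (_ : Fact p.Prime), p₁ ≤ p ∧ ∃ (s : ℕ) (c : Fin s → ℂ) (g : Fin s → ℂ[X]),
      (∀ i, (g i).natDegree ≤ p ^ 2) ∧ (∑ i, (g i).support.card) ^ 4 ≤ p ^ 3 ∧
      (∑ i, C (c i) * g i ^ 2) = 𝔉⟮p⟯ ∧ 2 ≤ s := by
  by_contra hne
  push Not at hne
  apply h
  refine ⟨0, p₁, fun p _ hp s c g hdeg hS hrep => ?_⟩
  exact absurd (two_le_of_feketeRep p c g hrep) (not_le.mpr (hne p inferInstance hp s c g hdeg hS hrep))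

/-- **Wall W2.**  If the crux fails then for every fan-in `D` and every threshold some prime `p` beyond it admits NO cyclic
characteristic-`p` representation of `F̄_p` with `≤ D` weighted squares of degree `< p` and total support `T`,
`2T² ≤ D²(p−1)` — a char-`p` lower bound beyond counting for `D ≥ 3` squares, unknown today. [folklore] -/
theorem charP_hard_of_not_sublinearShadow (h : ¬ SublinearShadow) (D p₁ : ℕ) :
    ∃ (p : ℕ) (_ : Fact p.Prime), p₁ ≤ p ∧ ∀ (T : ℕ), 2 * T ^ 2 ≤ D ^ 2 * (p - 1) →
      ¬ ∃ (K : Type) (_ : Field K) (_ : CharP K p) (d : ℕ) (c' : Fin d → K) (g' : Fin d → Polynomial K),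
          d ≤ D ∧ (∀ j, (g' j).natDegree < p) ∧ (∑ j, (g' j).support.card) ≤ T ∧
          ((Polynomial.X : Polynomial K) ^ p - 1 ∣ (∑ j, Polynomial.C (c' j) * g' j ^ 2)
            - ∑ m ∈ Finset.range p, Polynomial.C ((legendreSym p m : ℤ) : K) * Polynomial.X ^ m) := by
  by_contra hne
  push Not at hne
  apply h
  refine ⟨D, p₁, fun p _ hp s c g _hdeg _hS hrep => ?_⟩
  obtain ⟨T, hT, K, iF, iC, d, c', g', hd, hdeg', hsupp', hdvd'⟩ := hne p inferInstance hp
  set S : ℕ := ∑ i, (g i).support.card with hSdef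
  have hs2 : 2 ≤ s := two_le_of_feketeRep p c g hrep
  -- counting: `2(p-1) ≤ (S+1)·S`
  have hcount : 2 * (p - 1) ≤ (S + 1) * S :=
    FeketeSOSThinSquaresCovering.two_mul_pred_le_of_feketeRep p S c g
      (fun i => Finset.single_le_sum (f := fun j => (g j).support.card) (fun j _ => Nat.zero_le _)
        (Finset.mem_univ i)) hrep
  -- hence `T ≤ D·S`
  have hTS : T ≤ D * S := by
    have h4 : 4 * T ^ 2 ≤ D ^ 2 * S ^ 2 + D ^ 2 * S := by
      calc 4 * T ^ 2 = 2 * (2 * T ^ 2) := by ring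
        _ ≤ 2 * (D ^ 2 * (p - 1)) := Nat.mul_le_mul_left 2 hT
        _ = D ^ 2 * (2 * (p - 1)) := by ring
        _ ≤ D ^ 2 * ((S + 1) * S) := Nat.mul_le_mul_left _ hcount
        _ = D ^ 2 * S ^ 2 + D ^ 2 * S := by ring
    have hSS : D ^ 2 * S ≤ D ^ 2 * S ^ 2 := Nat.mul_le_mul_left _ (Nat.le_self_pow two_ne_zero S)
    by_contra hlt
    have h1 : D * S + 1 ≤ T := by omega
    have h2 : (D * S + 1) ^ 2 ≤ T ^ 2 := Nat.pow_le_pow_left h1 2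
    nlinarith [h4, h2, hSS]
  -- few squares: `D ≤ 2^D ≤ (s+1)^D`
  have hD : D ≤ (s + 1) ^ D :=
    (Nat.lt_two_pow_self).le.trans (Nat.pow_le_pow_left (by omega) D)
  exact ⟨K, iF, iC, d, c', g', hd.trans hD, hdeg', hsupp'.trans (hTS.trans (Nat.mul_le_mul_right _ hD)), hdvd'⟩

end

end Summit.ValiantsHypothesis.ValiantsHypothesis.Theorems.SublinearShadow.Negative
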